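/-
Copyright (c) 2026 the pub-hodgecm-mathlib formalisation cell (harness21).  Prover seat hodgecm-mathlib-F0P3a-p02 (g27), 2026-09-03.  Road M6 «ROW 2 ★ DYADIC TWIN» → F3
«TOT-Λ BY OVER-ORDERS» (LEAD F0P3a-plan T14-66 ∕ T15-08; WORD #77 queue), carve (c10b-S) «GATE AT b = 0, SUFFICIENCY» (F3-5 pen LH7-p04 (g12) 00:24:06Z ∕ 00:34:25Z),
part (S3-A) «THE ASSEMBLY» over (S3-W), (S3-D) (this seat) and (S1) «K-LINE GRAM» (LH10-p01 (g11)); (S2) «NORM SUPPLY» enters as the binder `hnormK`.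
-/
import Literature.NumberTheory.Automorphic.SelfDualProductOrderGateDetLink   -- (S3-D) (this seat): the determinant link; brings ★ (S3-W) `SelfDualProductOrderGateWitness` p853112 (the witness), ★ p853089∕p853106 `SelfDualProductOrderGate` (pairing lemmas)
import Literature.NumberTheory.Automorphic.SelfDualProductOrderKLine         -- (S1) (LH10-p01 (g11)): `kLine_gram_mem_integer_of_norm_eq`, `kLine_map_nu`
import HarnessLib

/-!
# The gate at glue depth `b = 0`, sufficiency: class I ⇒ a self-dual lattice cyclic for every product over-order (the assembly)

Topic `NumberTheory/Automorphic`; namespace `Literature.NumberTheory.Automorphic`.  THEOREMS ONLY (no definition, no instance, no notation, no named fact, no `sorry`);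
kernel lane `--supports stmt-HodgeConjecture-24833`.  Cell `pub/hodgecm-mathlib` (D-0151), crux H413 = `stmt-HodgeConjecture-24833`; road M6 → F3 «TOT-Λ by over-orders»,
carve (c10b) «gate at `b = 0`» for the F3-5b assembly (LH7-p04 (g12)).  **THE (⇐) HEAD IN THE PEN'S LETTERS** (00:24:06Z): for every PRODUCT stratum — `S ≤ 𝒪_E × 𝒪_K` with
`↑S = {z | ∃ p q, z.2 = jO p + jO q · Π_{N″}}`, `Π_{N″} = jO(ϖ^{N″})·θ`, read in `E × K` along `incl = (coe, coe)` — **`Even (log|⟨x₀, x₀⟩_J|) → ∃ b₀ : (E × K)ˣ, ∃ u ∈ U(σ, J),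
Λ_{incl S}(φ(b₀)w₀) = Λ(u)`** (★ F3-2a `ncard_setOf_selfDual_cyclicOver_eq_relIndex`'s witness `hb₀`; 5b-II's binder `hgate₀`, LH7-p04 (g12) 00:48:47Z), with the
CLASS-I TOKEN valuation-native as 5b-II has it: `∃ c ≠ 0, |σ(c)·c·⟨x₀, x₀⟩| = 1`, `x₀ := φ(1,0)w₀`, `⟨x₀, x₀⟩ := σ(x₀)ᵀ (J x₀)` (the negation of ★ (c10b-N)'s `hII`).  FRAME = ★ F3-2a ∕ F3-2b endoscopic letters VERBATIM (`σ σK hσσ hσO htr hnorm J hJ hJh τ hK φ hφ τB hτB hstar`), ★ (c4)'s integral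
letters (`jO`, `hjO`), ★ F3-1a's Eisenstein letters IN `𝒪_K` (`θ : 𝒪[K]`, `hθ : θ·θ = jO a·θ + jO k`, `σ_Kθ = θ`, `σa = a`, `σk = k`), the two valued structures
`[Valued E ℤᵐ⁰]`, `[Valued K ℤᵐ⁰]` (compatible with the valuative relations) with the ★ F4-gate letters `hσv : |σ·| = |·|`, `hjv : |algebraMap y|_K = |y|_E²` (ramified), `hθv :
|θ|_K = exp(−1)`, `hϖv : |ϖ|_E = exp(−1)`, `σϖ = ϖ`, `|k| = |ϖ|`, `|a| < 1`, `1, θ` `E`-independent, and ONE norm binder **`hnormK : ∀ x c : K, c ≠ 0 → σ_K c = c →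
|x·σ_K x| = |c| → ∃ t, t·σ_K t = c`** («a `σ_K`-fixed element with a norm's valuation is a norm» — the head of (S2) `QuadraticFixedNormSupply`, LH10-p01 (g11)).
No `2`, no `d`, no parity binder except the pen's class token; `n = 3`; `N″` arbitrary.
HONEST LABEL: HC_CM is proved only modulo the 7 printed citations (2 remaining named inputs: hLiu418 = stmt-HodgeConjecture-24832, h413 = stmt-HodgeConjecture-24833) until
rung 0 closes; elementary valuation algebra over ★ material, asserts nothing printed; count-neutral (zero label movement until F5 ★ and a desk-priced rider).

THE MATHEMATICS (SIG-c10b-S v1).  Class I (`|σ(c)c d₀| = 1`, `d₀ = ⟨x₀,x₀⟩`, `x₀ = φ(1,0)w₀`) reads `log|d₀|` even (`d₀ ≠ 0` by (S3-D)); take `c₀ := ϖ^{m}` with `2m = log|d₀|`, then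
`|σ(c₀)c₀d₀| = 1` (the `E`-line).  With `ℓ(y) := P(e₂,(0,y))`, `l₀ = ℓ(1)`, `l₁ = ℓ(θ)` (`σ`-fixed by hermitian symmetry), `Nν⋆ = l₁² − a l₀l₁ − k l₀²`: the DETERMINANT LINK
((S3-D)) `|d₀·Nν⋆| = |det M·σ(det M)|` makes `log|Nν⋆|` even; the ultrametric case analysis («case B» `|l₁|² < |ϖ||l₀|²` would give `|Nν⋆| = |k l₀²|`, odd `log`) forces CASE A
`|l₀θ|_K < |l₁|_K`, so `|ν⋆|_K = |l₁|_K` is a square and `ν = (ϖ^{N″}Nν⋆)⁻¹ν⋆` has `|ν|_K = |θ^{t}·σ_K θ^{t}|_K` for an explicit `t ∈ ℤ`; `hnormK` gives `b₂` with `b₂σ_K b₂ = ν`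
(`σ_K ν = ν`, ★ (S1) `kLine_map_nu`); ★ (S1′) `kLine_gram_mem_integer_of_norm_eq` gives the unimodular `K`-plane Gram `[[0,1],[1,ϖ^{N″}a]]` at `b₂`, read through ★ (S3-W)
`pairing_zero_snd_zero_snd_eq`; ★ (S3-W) `exists_selfDual_cyclicOver_map_of_kPlane_gram` assembles the witness `b₀ = (c₀, b₂)`.
[cite: Jacobowitz1962, §4, §7 Thm. 7.1] [cite: Rogawski1990, §4.9 Lemma 4.9.3 p. 56, Prop. 4.9.1 (b) p. 55] [cite: SerreLocalFields1979, Ch. V §2 Prop. 3] [cite: Neukirch1999, Ch. I §12]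

* §1 `map_dotProduct_mulVec_eq_swap` (hermitian symmetry `σ P(v, w) = P(w, v)`), `valued_v_eq_of_valuation_eq`, `valuation_eq_one_of_valued_v_eq_one` (bridges),
  `v_algebraMap_mul_theta_lt_of_even_log_norm` (case A from the parity of `log|Nν⋆|`).
* §2 **`exists_selfDual_cyclicOver_map_of_even_log`** (the pen's (⇐) head).

## References
* [Jacobowitz1962] R. Jacobowitz, *Hermitian forms over local fields*, Amer. J. Math. 84 (1962): §4, §7 Thm. 7.1 (unimodular lattices, Gram criterion).
* [Rogawski1990] J. D. Rogawski, *Automorphic Representations of Unitary Groups in Three Variables*, Ann. of Math. Stud. 123 (1990): §4.9 Lemma 4.9.3 p. 56, Prop. 4.9.1 (b) p. 55.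
* [SerreLocalFields1979] J.-P. Serre, *Local Fields*, GTM 67 (1979): Ch. V §2 Prop. 3 (norms at an unramified quadratic extension), Ch. II §2 (`|j x|_K = |x|_E^e`).
* [Neukirch1999] J. Neukirch, *Algebraic Number Theory*, Grundlehren 322 (1999): Ch. I §12 (orders; product orders).
-/

set_option autoImplicit false

noncomputable section

open Matrix
open scoped MatrixGroups ValuativeRel

namespace Literature.NumberTheory.Automorphic

open Literature.NumberTheory.Automorphic.UnitaryGroup

open scoped _root_.WithZero

/-! ## §1 Hermitian symmetry, valuation bridges, and «case A» from the parity of `log|Nν⋆|` -/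

section Lemmas

variable {E : Type*} [Field E] {n : ℕ} (σ : E →+* E)

/-- HERMITIAN SYMMETRY of the pairing: `σ(σ(v)ᵀ J w) = σ(w)ᵀ J v` for `σ` an involution and `σ(J)ᵀ = J`. [cite: Jacobowitz1962, §4] -/
theorem map_dotProduct_mulVec_eq_swap (hσσ : ∀ x, σ (σ x) = x) (J : Matrix (Fin n) (Fin n) E) (hJh : (J.map σ)ᵀ = J) (v w : Fin n → E) :
    σ (dotProduct (fun i => σ (v i)) (J *ᵥ w)) = dotProduct (fun i => σ (w i)) (J *ᵥ v) := by
  have hJ' : ∀ i j, σ (J i j) = J j i := fun i j => by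
    have h := congrFun (congrFun hJh j) i
    rwa [Matrix.transpose_apply, Matrix.map_apply] at h
  simp only [dotProduct, Matrix.mulVec, map_sum, map_mul, hσσ, hJ', Finset.mul_sum]
  rw [Finset.sum_comm]
  exact Finset.sum_congr rfl fun i _ => Finset.sum_congr rfl fun j _ => by ring

variable [Valued E ℤᵐ⁰] [ValuativeRel E] [(Valued.v : Valuation E ℤᵐ⁰).Compatible]

/-- `Valued.v x = Valued.v y` from `valuation E x = valuation E y` (compatible valuations). [cite: SerreLocalFields1979, Ch. II §2] -/
theorem valued_v_eq_of_valuation_eq {x y : E} (h : ValuativeRel.valuation E x = ValuativeRel.valuation E y) : Valued.v x = Valued.v y := by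
  have hle : ∀ a b : E, Valued.v a ≤ Valued.v b ↔ ValuativeRel.valuation E a ≤ ValuativeRel.valuation E b := fun a b => by
    rw [← Valuation.vle_iff_le (Valued.v : Valuation E ℤᵐ⁰), Valuation.vle_iff_le (ValuativeRel.valuation E)]
  exact le_antisymm ((hle x y).2 h.le) ((hle y x).2 h.ge)

/-- `valuation E x = 1` from `Valued.v x = 1` (compatible valuations). [cite: SerreLocalFields1979, Ch. II §2] -/
theorem valuation_eq_one_of_valued_v_eq_one {x : E} (h : Valued.v x = 1) : ValuativeRel.valuation E x = 1 := by
  have hle : ∀ a b : E, ValuativeRel.valuation E a ≤ ValuativeRel.valuation E b ↔ Valued.v a ≤ Valued.v b := fun a b => by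
    rw [← Valuation.vle_iff_le (ValuativeRel.valuation E), Valuation.vle_iff_le (Valued.v : Valuation E ℤᵐ⁰)]
  have h1 := (hle x 1).2 (by rw [h, map_one])
  have h2 := (hle 1 x).2 (by rw [h, map_one])
  rw [map_one] at h1 h2
  exact le_antisymm h1 h2

omit [ValuativeRel E] [(Valued.v : Valuation E ℤᵐ⁰).Compatible] in
/-- **CASE A FROM THE PARITY OF `log|Nν⋆|`.**  In the ramified quadratic `K ⊇ E` (`|algebraMap y|_K = |y|_E²`, `|θ|_K = exp(−1)`, `|ϖ|_E = exp(−1)`, `|k| = |ϖ|`, `|a| < 1`):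
if `Nν⋆ := l₁² − a l₀ l₁ − k l₀² ≠ 0` has EVEN `log|Nν⋆|`, then `|l₀·θ|_K < |l₁|_K` — for otherwise `|l₁|² < |ϖ||l₀|²` (parities differ), the term `k l₀²` dominates
ultrametrically and `log|Nν⋆| = 2 log|l₀| − 1` is odd. [cite: SerreLocalFields1979, Ch. II §2] [cite: Neukirch1999, Ch. I §12] -/
theorem v_algebraMap_mul_theta_lt_of_even_log_norm {K : Type*} [Field K] [Valued K ℤᵐ⁰] [Algebra E K]
    (hjv : ∀ y : E, Valued.v (algebraMap E K y) = Valued.v y ^ 2) {θ : K} (hθv : Valued.v θ = WithZero.exp (-1 : ℤ))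
    {ϖ a k : E} (hϖv : Valued.v ϖ = WithZero.exp (-1 : ℤ)) (hkv : Valued.v k = Valued.v ϖ) (hav : Valued.v a < 1) (l₀ l₁ : E)
    (hN : l₁ ^ 2 - a * l₀ * l₁ - k * l₀ ^ 2 ≠ 0) (heven : Even (WithZero.log (Valued.v (l₁ ^ 2 - a * l₀ * l₁ - k * l₀ ^ 2)))) :
    Valued.v (algebraMap E K l₀ * θ) < Valued.v (algebraMap E K l₁) := by
  by_contra hle
  rw [not_lt] at hle
  -- `l₀ ≠ 0`
  have hl0 : l₀ ≠ 0 := by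
    intro h0
    rw [h0, map_zero, zero_mul, map_zero, le_zero_iff, hjv, pow_eq_zero_iff two_ne_zero, Valuation.zero_iff] at hle
    exact hN (by rw [h0, hle]; ring)
  have hB0 : Valued.v l₀ ≠ 0 := (Valuation.ne_zero_iff _).2 hl0
  have hk0 : Valued.v k ≠ 0 := by rw [hkv, hϖv]; exact WithZero.exp_ne_zero
  set B : ℤ := WithZero.log (Valued.v l₀) with hB
  have hvB : Valued.v l₀ = WithZero.exp B := by rw [hB, WithZero.exp_log hB0]
  -- the dominant term `k l₀²`
  have hvk2 : Valued.v (k * l₀ ^ 2) = WithZero.exp (2 * B - 1) := by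
    rw [map_mul, map_pow, hkv, hϖv, hvB, ← WithZero.exp_nsmul, ← WithZero.exp_add]
    congr 1; simp only [nsmul_eq_mul, Nat.cast_ofNat]; ring
  -- `|l₁²| < |k l₀²|` and `|a l₀ l₁| < |k l₀²|`
  have hlt1 : Valued.v (l₁ ^ 2) < Valued.v (k * l₀ ^ 2) ∧ Valued.v (a * l₀ * l₁) < Valued.v (k * l₀ ^ 2) := by
    rcases eq_or_ne l₁ 0 with h1 | h1
    · rw [h1]; simp only [ne_eq, OfNat.ofNat_ne_zero, not_false_eq_true, zero_pow, map_zero, mul_zero, hvk2]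
      exact ⟨WithZero.exp_pos, WithZero.exp_pos⟩
    · have hA0 : Valued.v l₁ ≠ 0 := (Valuation.ne_zero_iff _).2 h1
      set A : ℤ := WithZero.log (Valued.v l₁) with hA
      have hvA : Valued.v l₁ = WithZero.exp A := by rw [hA, WithZero.exp_log hA0]
      -- `2A ≤ 2B − 1`, hence `A ≤ B − 1`
      have hAB : A ≤ B - 1 := by
        have h := hle
        rw [map_mul, hjv, hjv, hθv, hvA, hvB, ← WithZero.exp_nsmul, ← WithZero.exp_nsmul, ← WithZero.exp_add, WithZero.exp_le_exp] at h
        simp only [nsmul_eq_mul, Nat.cast_ofNat] at h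
        omega
      refine ⟨?_, ?_⟩
      · rw [map_pow, hvA, hvk2, ← WithZero.exp_nsmul, WithZero.exp_lt_exp]
        simp only [nsmul_eq_mul, Nat.cast_ofNat]; omega
      · have hav' : Valued.v (a * l₀ * l₁) ≤ Valued.v (l₀ * l₁) := by
          rw [mul_assoc, map_mul, map_mul (Valued.v) l₀]
          exact mul_le_of_le_one_left' hav.le
        have hav'' : Valued.v (a * l₀ * l₁) < Valued.v (l₀ * l₁) ∨ a = 0 := by
          rcases eq_or_ne a 0 with ha0 | ha0
          · exact Or.inr ha0
          · left
            rw [mul_assoc, map_mul, map_mul (Valued.v) l₀]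
            exact mul_lt_of_lt_one_left (by rw [← map_mul]; exact (Valuation.pos_iff _).2 (mul_ne_zero hl0 h1)) hav
        have hll : Valued.v (l₀ * l₁) ≤ Valued.v (k * l₀ ^ 2) := by
          rw [map_mul, hvA, hvB, hvk2, ← WithZero.exp_add, WithZero.exp_le_exp]; omega
        rcases hav'' with h | h
        · exact lt_of_lt_of_le h hll
        · rw [h, zero_mul, zero_mul, map_zero, hvk2]; exact WithZero.exp_pos
  -- hence `|Nν⋆| = |k l₀²|`, odd `log`
  have hdom : Valued.v (l₁ ^ 2 - a * l₀ * l₁ - k * l₀ ^ 2) = Valued.v (k * l₀ ^ 2) := by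
    have h : l₁ ^ 2 - a * l₀ * l₁ - k * l₀ ^ 2 = -(k * l₀ ^ 2) + (l₁ ^ 2 + -(a * l₀ * l₁)) := by ring
    rw [h, Valuation.map_add_eq_of_lt_left, Valuation.map_neg]
    rw [Valuation.map_neg]
    exact Valuation.map_add_lt _ hlt1.1 (by rw [Valuation.map_neg]; exact hlt1.2)
  rw [hdom, hvk2, WithZero.log_exp] at heven
  obtain ⟨r, hr⟩ := heven
  omega

end Lemmas

/-! ## §2 The (⇐) head: class I ⇒ a witness at every product stratum -/

section Assembly

variable {E : Type*} [Field E] [Valued E ℤᵐ⁰] [ValuativeRel E] [(Valued.v : Valuation E ℤᵐ⁰).Compatible] (σ : E →+* E)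
  {K : Type*} [Field K] [Valued K ℤᵐ⁰] [ValuativeRel K] [Algebra E K] (σK : K →+* K)
  (hσσ : ∀ x, σ (σ x) = x) (hσO : ∀ x : 𝒪[E], σ x ∈ 𝒪[E])
  (htr : ∃ b : 𝒪[E], (b : E) + σ b = 1) (hnorm : ∀ u : 𝒪[E], IsUnit u → σ u = u → ∃ t : 𝒪[E], (t : E) * σ t = u)
  (J : GL (Fin 3) E) (hJ : J ∈ glInt 3 E) (hJh : ((J : Matrix (Fin 3) (Fin 3) E).map σ)ᵀ = J)
  (τ : Matrix (Fin 3) (Fin 3) E) {w₀ : Fin 3 → E} (hK : IsUnit (Matrix.of fun i j : Fin 3 => ((τ ^ (j : ℕ)) *ᵥ w₀) i).det)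
  (φ : (E × K) →ₐ[E] Matrix (Fin 3) (Fin 3) E) (hφ : Function.Injective φ) (τB : E × K) (hτB : φ τB = τ)
  (hstar : ∀ b : E × K, (J : Matrix (Fin 3) (Fin 3) E) * φ (RingHom.prodMap σ σK b) = ((φ b).map σ)ᵀ * J)

include hσσ hσO htr hnorm hJ hJh hK hφ hτB hstar in
/-- **THE GATE AT `b = 0`, SUFFICIENCY: CLASS I ⇒ A SELF-DUAL LATTICE CYCLIC FOR EVERY PRODUCT OVER-ORDER** (the F3-5 pen's (⇐) head at the strata `G(N″, 0, c′)`, ★ F3-2a's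
witness `hb₀` at `O := incl S`).  See the module docstring for the letters; the proof is `x₀ = c·x₀′` ⟶ `log|d₀|` even ⟶ `c₀ = ϖ^m` ⟶ determinant link ((S3-D)) ⟶ `log|Nν⋆|` even ⟶
case A ⟶ `|ν|_K = |θ^t σ_K θ^t|` ⟶ `hnormK` ⟶ `b₂` ⟶ ★ (S1′) `kLine_gram_mem_integer_of_norm_eq` ⟶ ★ (S3-W) `exists_selfDual_cyclicOver_map_of_kPlane_gram`.
[cite: Jacobowitz1962, §4, §7 Thm. 7.1] [cite: Rogawski1990, §4.9 Lemma 4.9.3 p. 56, Prop. 4.9.1 (b) p. 55] [cite: SerreLocalFields1979, Ch. V §2 Prop. 3] [cite: Neukirch1999, Ch. I §12] -/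
theorem exists_selfDual_cyclicOver_map_of_even_log (hσv : ∀ x, Valued.v (σ x) = Valued.v x)
    (jO : 𝒪[E] →+* 𝒪[K]) (hjO : ∀ y : 𝒪[E], ((jO y : 𝒪[K]) : K) = algebraMap E K (y : E))
    (θ : 𝒪[K]) {a k : 𝒪[E]} (hθ : θ * θ = jO a * θ + jO k)
    (hσKE : ∀ y : E, σK (algebraMap E K y) = algebraMap E K (σ y)) (hσKθ : σK (θ : K) = θ) (hσa : σ (a : E) = a) (hσk : σ (k : E) = k)
    (hθE : ∀ p q : E, algebraMap E K p + algebraMap E K q * (θ : K) = 0 → p = 0 ∧ q = 0)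
    (hjv : ∀ y : E, Valued.v (algebraMap E K y) = Valued.v y ^ 2) (hθv : Valued.v (θ : K) = WithZero.exp (-1 : ℤ))
    {ϖ : E} (hϖ : IsUniformizingElement ϖ) (hϖv : Valued.v ϖ = WithZero.exp (-1 : ℤ)) (hσϖ : σ ϖ = ϖ)
    (hkv : Valued.v (k : E) = Valued.v ϖ) (hav : Valued.v (a : E) < 1)
    (hnormK : ∀ x c : K, c ≠ 0 → σK c = c → Valued.v (x * σK x) = Valued.v c → ∃ t : K, t * σK t = c)
    (S : Subring (𝒪[E] × 𝒪[K])) (N'' : ℕ)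
    (hS : (S : Set (𝒪[E] × 𝒪[K])) = {z : 𝒪[E] × 𝒪[K] | ∃ p q : 𝒪[E], z.2 = jO p + jO q * (jO ((⟨ϖ, hϖ.mem⟩ : 𝒪[E]) ^ N'') * θ)})
    (hI : ∃ c : E, c ≠ 0 ∧ ValuativeRel.valuation E (σ c * c *
      dotProduct (fun i => σ ((φ ((1, 0) : E × K) *ᵥ w₀) i)) ((J : Matrix (Fin 3) (Fin 3) E) *ᵥ (φ ((1, 0) : E × K) *ᵥ w₀))) = 1) :
    ∃ b₀ : (E × K)ˣ, ∃ u ∈ unitaryGroupOfForm σ (J : Matrix (Fin 3) (Fin 3) E),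
      Submodule.span 𝒪[E] ((fun x : E × K => φ x *ᵥ (φ (b₀ : E × K) *ᵥ w₀)) ''
          (S.map (RingHom.prodMap (𝒪[E]).subtype (𝒪[K]).subtype) : Set (E × K))) =
        Submodule.span 𝒪[E] (Set.range ((u : Matrix (Fin 3) (Fin 3) E))ᵀ) := by
  classical
  -- letters
  set θK : K := (θ : K) with hθKdef
  set aE : E := (a : E) with haE
  set kE : E := (k : E) with hkE
  set π : 𝒪[E] := ⟨ϖ, hϖ.mem⟩ with hπ
  set PiN : 𝒪[K] := jO (π ^ N'') * θ with hPiN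
  set e₁ : E × K := (1, 0) with he₁
  set x₀' : Fin 3 → E := φ e₁ *ᵥ w₀ with hx₀'
  set d₀ : E := dotProduct (fun i => σ (x₀' i)) ((J : Matrix (Fin 3) (Fin 3) E) *ᵥ x₀') with hd₀
  set ℓ : K → E := fun z => dotProduct (fun i => σ ((φ ((0, 1) : E × K) *ᵥ w₀) i)) ((J : Matrix (Fin 3) (Fin 3) E) *ᵥ (φ ((0, z) : E × K) *ᵥ w₀)) with hℓ
  set l₀ : E := ℓ 1 with hl₀
  set l₁ : E := ℓ θK with hl₁
  set Nn : E := l₁ ^ 2 - aE * l₀ * l₁ - kE * l₀ ^ 2 with hNn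
  have hϖ0 : ϖ ≠ 0 := hϖ.ne_zero
  have hθK0 : θK ≠ 0 := fun h0 => by
    have h := hθv; rw [h0, map_zero] at h; exact WithZero.exp_ne_zero h.symm
  -- the Eisenstein relation at the field level
  have hθK : θK * θK = algebraMap E K aE * θK + algebraMap E K kE := by
    have h := congrArg (fun z : 𝒪[K] => (z : K)) hθ
    simp only [Subring.coe_mul, Subring.coe_add, hjO] at h
    exact h
  have hθK2 : θK ^ 2 = algebraMap E K aE * θK + algebraMap E K kE := by rw [sq]; exact hθK
  have hPiNK : ((PiN : 𝒪[K]) : K) = algebraMap E K (ϖ ^ N'') * θK := by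
    rw [hPiN, Subring.coe_mul, hjO, Subring.coe_pow]
  -- `ℓ` is `E`-linear, `l₀, l₁` are `σ`-fixed
  have hadd : ∀ x y : K, ℓ (x + y) = ℓ x + ℓ y := fun x y => pairing_zero_snd_add_right σ J φ (0, 1) x y
  have hsmul : ∀ (c : E) (y : K), ℓ (algebraMap E K c * y) = c * ℓ y := fun c y => pairing_zero_snd_smul_right σ J φ (0, 1) c y
  have hσl₀ : σ l₀ = l₀ := map_dotProduct_mulVec_eq_swap σ hσσ (J : Matrix (Fin 3) (Fin 3) E) hJh _ _
  have hσl₁ : σ l₁ = l₁ := by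
    rw [hl₁, hℓ]
    change σ (dotProduct (fun i => σ ((φ ((0, 1) : E × K) *ᵥ w₀) i)) ((J : Matrix (Fin 3) (Fin 3) E) *ᵥ (φ ((0, θK) : E × K) *ᵥ w₀))) = _
    rw [map_dotProduct_mulVec_eq_swap σ hσσ (J : Matrix (Fin 3) (Fin 3) E) hJh]
    exact pairing_theta_one_eq σ σK J φ hstar hσKθ
  -- (a) class I: `|σ(c)·c·d₀| = 1` for some `c ≠ 0`
  obtain ⟨cI, hcI0, hcI⟩ := hI
  have hcIv : Valued.v (σ cI * cI * d₀) = 1 := valued_v_eq_one_of_valuation_eq_one hcI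
  -- (b) the determinant link: `|d₀ · Nν⋆| = |det M · σ(det M)|`, `d₀ ≠ 0`, `Nν⋆ ≠ 0`
  obtain ⟨hlink, hd00, hNn0'⟩ := valuation_pairing_mul_norm_eq σ σK J hJ τ hK φ hφ τB hτB hstar hθK2 hσKθ hθE
  have hNn0 : Nn ≠ 0 := by
    intro h0; apply hNn0'
    have : l₁ * l₁ - aE * l₀ * l₁ - kE * l₀ * l₀ = Nn := by rw [hNn]; ring
    exact this.trans h0
  have hlinkv := valued_v_eq_of_valuation_eq hlink
  -- `log|d₀|` is even
  have hD0 : Valued.v d₀ ≠ 0 := (Valuation.ne_zero_iff _).2 hd00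
  have hA0 : Valued.v cI ≠ 0 := (Valuation.ne_zero_iff _).2 hcI0
  have hd₀even : Even (WithZero.log (Valued.v d₀)) := by
    have h := congrArg WithZero.log hcIv
    rw [map_mul, map_mul, hσv, WithZero.log_mul (mul_ne_zero hA0 hA0) hD0, WithZero.log_mul hA0 hA0, WithZero.log_one] at h
    exact ⟨-WithZero.log (Valued.v cI), by omega⟩
  -- `log|Nν⋆|` is even
  set M : Matrix (Fin 3) (Fin 3) E :=
    Matrix.of fun i j => (![φ ((1, 0) : E × K) *ᵥ w₀, φ ((0, 1) : E × K) *ᵥ w₀, φ ((0, θK) : E × K) *ᵥ w₀] : Fin 3 → Fin 3 → E) j i with hMdef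
  have hMne : M.det ≠ 0 := det_basis_ne_zero τ hK φ hφ τB hτB hθE
  have hNn_eq : l₁ * l₁ - aE * l₀ * l₁ - kE * l₀ * l₀ = Nn := by rw [hNn]; ring
  have hNv0 : Valued.v Nn ≠ 0 := (Valuation.ne_zero_iff _).2 hNn0
  have hMv0 : Valued.v M.det ≠ 0 := (Valuation.ne_zero_iff _).2 hMne
  have hNeven : Even (WithZero.log (Valued.v Nn)) := by
    have h := congrArg WithZero.log hlinkv
    rw [hNn_eq, map_mul, map_mul, hσv, WithZero.log_mul hD0 hNv0, WithZero.log_mul hMv0 hMv0] at h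
    obtain ⟨r, hr⟩ := hd₀even
    exact ⟨WithZero.log (Valued.v M.det) - r, by omega⟩
  -- (c) case A, `|ν⋆|_K = |l₁|_K`
  have hcaseA : Valued.v (algebraMap E K l₀ * θK) < Valued.v (algebraMap E K l₁) :=
    v_algebraMap_mul_theta_lt_of_even_log_norm hjv hθv hϖv hkv hav l₀ l₁ hNn0 hNeven
  have hl10 : l₁ ≠ 0 := fun h0 => by
    rw [h0, map_zero, map_zero] at hcaseA; exact not_lt_of_ge zero_le hcaseA
  have hνstar : Valued.v (algebraMap E K l₁ - algebraMap E K l₀ * θK) = Valued.v (algebraMap E K l₁) := by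
    rw [sub_eq_add_neg, Valuation.map_add_eq_of_lt_left]
    rwa [Valuation.map_neg]
  -- (d) `ν`, its valuation, and `x := θ^t` with `|x σ_K x| = |ν|`
  set ν : K := algebraMap E K (ϖ ^ N'' * Nn)⁻¹ * (algebraMap E K l₁ - algebraMap E K l₀ * θK) with hν
  have hscal0 : ϖ ^ N'' * Nn ≠ 0 := mul_ne_zero (pow_ne_zero _ hϖ0) hNn0
  have hν0 : ν ≠ 0 := by
    refine mul_ne_zero ((map_ne_zero _).2 (inv_ne_zero hscal0)) fun h0 => ?_
    rw [h0, map_zero] at hνstar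
    exact hl10 ((map_eq_zero _).1 ((Valuation.zero_iff _).1 hνstar.symm))
  have hσν : σK ν = ν := by
    rw [hν]; exact kLine_map_nu θK ϖ N'' σ σK hσKE hσKθ hσl₀ hσl₁ hσa hσk hσϖ
  set L1 : ℤ := WithZero.log (Valued.v l₁) with hL1
  set LN : ℤ := WithZero.log (Valued.v Nn) with hLN
  have hvl₁ : Valued.v l₁ = WithZero.exp L1 := by rw [hL1, WithZero.exp_log ((Valuation.ne_zero_iff _).2 hl10)]
  have hvNn : Valued.v Nn = WithZero.exp LN := by rw [hLN, WithZero.exp_log hNv0]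
  have hvν : Valued.v ν = WithZero.exp (2 * (N'' - LN + L1)) := by
    rw [hν, map_mul, hνstar, hjv, hjv, map_inv₀, map_mul, map_pow, hϖv, hvNn, hvl₁, ← WithZero.exp_nsmul, ← WithZero.exp_add, ← WithZero.exp_neg,
      ← WithZero.exp_nsmul, ← WithZero.exp_nsmul, ← WithZero.exp_add]
    congr 1; simp only [nsmul_eq_mul, Nat.cast_ofNat]; ring
  set t : ℤ := N'' - LN + L1 with ht
  set x : K := θK ^ (-t) with hx
  have hxσ : σK x = x := by rw [hx, map_zpow₀, hσKθ]
  have hvx : Valued.v (x * σK x) = Valued.v ν := by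
    rw [hxσ, map_mul, hx, map_zpow₀, hθv, ← WithZero.exp_zsmul, ← WithZero.exp_add, hvν]
    congr 1; simp only [zsmul_eq_mul]; push_cast; ring
  -- (e) `b₂` from the norm binder, the `K`-plane Gram from (S1′)
  obtain ⟨b₂, hb₂⟩ := hnormK x ν hν0 hσν hvx
  have hϖO : ϖ ∈ 𝒪[E] := hϖ.mem
  obtain ⟨g00, g01, g10, g11, gdet⟩ := kLine_gram_mem_integer_of_norm_eq θK hθK ℓ hadd hsmul rfl rfl ϖ N'' σ σK hσKE hσKθ hσϖ a.2 hϖO hϖ0 hNn0 b₂ hb₂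
  -- read the four values as pairings `P((0,y),(0,y′))`
  have hT : ∀ y y' : K, dotProduct (fun i => σ ((φ ((0, y) : E × K) *ᵥ w₀) i)) ((J : Matrix (Fin 3) (Fin 3) E) *ᵥ (φ ((0, y') : E × K) *ᵥ w₀)) =
      ℓ (σK y * y') := fun y y' => pairing_zero_snd_zero_snd_eq σ σK J φ hstar y y'
  have hPb : (PiN : K) * b₂ = algebraMap E K (ϖ ^ N'') * θK * b₂ := by rw [hPiNK]
  -- (f) the `E`-line unit `c₀ = ϖ^m`, `2m = log|d₀|`
  obtain ⟨m₀, hm₀⟩ := hd₀even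
  set c₀ : E := ϖ ^ m₀ with hc₀
  have hσc₀ : σ c₀ = c₀ := by rw [hc₀, map_zpow₀, hσϖ]
  have hc₀v : Valued.v (σ c₀ * c₀ * d₀) = 1 := by
    have hd₀v : Valued.v d₀ = WithZero.exp (m₀ + m₀) := by rw [← hm₀, WithZero.exp_log hD0]
    rw [hσc₀, map_mul, map_mul, hc₀, map_zpow₀, hϖv, hd₀v, ← WithZero.exp_zsmul, ← WithZero.exp_add, ← WithZero.exp_add, ← WithZero.exp_zero]
    congr 1; simp only [zsmul_eq_mul]; push_cast; ring
  have hc₀1 : ValuativeRel.valuation E (σ c₀ * c₀ * d₀) = 1 := valuation_eq_one_of_valued_v_eq_one hc₀v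
  -- (g) assemble with ★ (S3-W)
  refine exists_selfDual_cyclicOver_map_of_kPlane_gram σ σK hσσ hσO htr hnorm J hJ hJh φ hstar jO hjO S PiN (by rw [hS]) c₀ hc₀1 b₂ ?_ ?_ ?_ ?_ ?_
  · rw [hT]; exact g00
  · rw [hT, hPb]; exact g01
  · rw [hT, hPb]; exact g10
  · rw [hT, hPb]; exact g11
  · rw [hT, hT, hT, hT, hPb]; exact gdet

end Assembly

end Literature.NumberTheory.Automorphic

end
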